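import Literature.NumberTheory.LFunctions.GaussianHeckeLogDerivPackage
import HarnessLib

/-!
# Landau's bound `D_m'/D_m(s) ≪ ℒ²/δ` inside a zero-free rectangle, for the Hecke `L`-functions of `ℚ(i)`

Topic `Literature/NumberTheory/LFunctions`.  For `D_m = 4 L(·, λ^m)`, `m ≥ 1`
(`Literature.NumberTheory.LFunctions.GaussianHecke.heckeL`) we PROVE the zero-free-region-agnostic form
of Montgomery–Vaughan's Theorem 6.7 / 11.4 estimate:

* `GaussianHecke.exists_norm_logDeriv_le_of_zeroFree` — there is an absolute `C₁` such that for every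
  `m ≥ 1`, `0 < δ ≤ 5/64`, `H ≥ 0`: **if `D_m(z) ≠ 0` for `Re z ≥ 1 - δ`, `|Im z| ≤ H + 1`, then
  `‖D_m'(s)/D_m(s)‖ ≤ C₁ log²(H + 2m + 6)/δ` for `1 - δ/2 ≤ Re s ≤ 2`, `|Im s| ≤ H`.**

Proof: the Lemma-α package `D_m'/D_m = ψ + ∑_{a ∈ S} mult(a)/(s - a)` on the disc around `17/16 + it`
(`GaussianHecke.exists_logDeriv_package`), `‖ψ‖ ≤ Eℒ`, total multiplicity `≤ 8(8 + K₀ + E)ℒ²`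
(`GaussianHecke.sum_mult_le`), and `|s - a| ≥ δ/2` for every zero `a` of the package (which has
`|Im a| ≤ |t| + 13/32 ≤ H + 1`, hence `Re a < 1 - δ`); for `Re s > 17/16` the trivial bound
`1/(σ - 1) + K₀ ≤ 16 + K₀`.  This is the input of the twisted prime-ideal theorem for `λ^m` at a scale
with a Vinogradov–Korobov (Coleman) region (sequel), i.e. of Harman's Lemma 11.6.

## References

* H. L. Montgomery, R. C. Vaughan, *Multiplicative Number Theory I*, CUP 2007, Theorem 6.7 and
  Theorem 11.4 (proofs). [MontgomeryVaughan2007]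
* G. Harman, *Prime-Detecting Sieves*, Princeton UP 2007, Lemma 11.6 (the consumer). [Harman2007]
-/

noncomputable section

open Complex Filter Topology Metric Set Finset

namespace Literature.NumberTheory.LFunctions

namespace GaussianHecke

/-- `‖(n : ℂ)/z‖ ≤ n · (2/δ)` when `‖z‖ ≥ δ/2 > 0`. [folklore] -/
theorem norm_natCast_div_le {n : ℕ} {δ : ℝ} (hδ : 0 < δ) {z : ℂ} (hz : δ / 2 ≤ ‖z‖) :
    ‖(n : ℂ) / z‖ ≤ n * (2 / δ) := by
  have hz0 : 0 < ‖z‖ := lt_of_lt_of_le (by positivity) hz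
  rw [norm_div, Complex.norm_natCast, div_eq_mul_inv]
  refine mul_le_mul_of_nonneg_left ?_ (Nat.cast_nonneg n)
  rw [inv_le_comm₀ hz0 (by positivity), inv_div]
  exact hz

/-- Monotonicity of the logarithmic factor: `log(|t| + 2m + 5) ≤ log(H + 2m + 6)` for `|t| ≤ H + 1`.
[folklore] -/
theorem ell_le_of_abs_le {m : ℕ} {t H : ℝ} (ht : |t| ≤ H + 1) :
    Real.log (|t| + 2 * m + 5) ≤ Real.log (H + 2 * m + 6) := by
  have h0 : 0 < |t| + 2 * m + 5 := by positivity
  exact Real.log_le_log h0 (by linarith)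

/-- **Landau's bound for `D_m'/D_m` in a zero-free rectangle** (MV Theorem 11.4, proof, for `λ^m`):
there is an absolute `C₁ ≥ 0` such that for all `m ≥ 1`, `0 < δ ≤ 5/64` and `H ≥ 0`, if `D_m` has no
zero in `Re z ≥ 1 - δ`, `|Im z| ≤ H + 1`, then for `1 - δ/2 ≤ Re s ≤ 2`, `|Im s| ≤ H`:
`D_m(s) ≠ 0` and `‖D_m'(s)/D_m(s)‖ ≤ C₁ log²(H + 2m + 6) / δ`.
[cite: MontgomeryVaughan2007, Theorem 11.4 (proof)] -/
theorem exists_norm_logDeriv_le_of_zeroFree :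
    ∃ C₁ : ℝ, 0 ≤ C₁ ∧ ∀ (m : ℕ), m ≠ 0 → ∀ (δ H : ℝ), 0 < δ → δ ≤ 5 / 64 → 0 ≤ H →
      (∀ z : ℂ, 1 - δ ≤ z.re → |z.im| ≤ H + 1 → heckeL m z ≠ 0) →
      ∀ s : ℂ, 1 - δ / 2 ≤ s.re → s.re ≤ 2 → |s.im| ≤ H →
        heckeL m s ≠ 0 ∧
          ‖deriv (heckeL m) s / heckeL m s‖ ≤ C₁ * Real.log (H + 2 * m + 6) ^ 2 / δ := by
  obtain ⟨K₀, hK₀, hK⟩ := exists_norm_heckeP_le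
  obtain ⟨E, hE, hpackage⟩ := exists_logDeriv_package
  set C₁ : ℝ := E + 16 * (8 + K₀ + E) + (16 + K₀) with hC₁
  refine ⟨C₁, by positivity, fun m hm δ H hδ hδ1 hH hzf s hre hre2 hsH ↦ ?_⟩
  have hm1 : (1 : ℝ) ≤ m := by exact_mod_cast Nat.one_le_iff_ne_zero.mpr hm
  have hδ1' : δ ≤ 1 := by linarith
  -- the logarithmic factor
  set ℒ : ℝ := Real.log (H + 2 * m + 6) with hℒdef
  have hℓ : Real.log (|s.im| + 2 * m + 5) ≤ ℒ := ell_le_of_abs_le (by linarith)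
  have hℓ1 : 1 ≤ Real.log (|s.im| + 2 * m + 5) := one_le_ell hm s.im
  have hℒ1 : 1 ≤ ℒ := hℓ1.trans hℓ
  have hℒ0 : 0 < ℒ := by linarith
  -- `s` itself lies in the zero-free rectangle
  have hLs : heckeL m s ≠ 0 := hzf s (by linarith) (by linarith)
  refine ⟨hLs, ?_⟩
  have hCpos : 0 ≤ C₁ := by positivity
  have hfinal : C₁ * ℒ ^ 2 / 1 ≤ C₁ * ℒ ^ 2 / δ :=
    div_le_div_of_nonneg_left (by positivity) hδ hδ1'
  rw [div_one] at hfinal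
  have hℒ2 : ℒ ≤ ℒ ^ 2 := by nlinarith
  have hℒ21 : 1 ≤ ℒ ^ 2 := one_le_pow₀ hℒ1
  rcases le_or_gt s.re (17 / 16) with hσ | hσ
  · obtain ⟨S, mult, ψ, hS, -, hψ, hψb⟩ := hpackage m hm s.im
    have hsc : s - (17 / 16 + s.im * I) = ((s.re - 17 / 16 : ℝ) : ℂ) :=
      Complex.ext (by simp) (by simp)
    have hball : s ∈ closedBall (17 / 16 + s.im * I) (13 / 128) := by
      rw [mem_closedBall, dist_eq_norm, hsc, Complex.norm_real, Real.norm_eq_abs, abs_le]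
      constructor <;> linarith
    have hball' : s ∈ ball (17 / 16 + s.im * I) (13 / 32) := by
      rw [mem_ball, dist_eq_norm, hsc, Complex.norm_real, Real.norm_eq_abs, abs_lt]
      constructor <;> linarith
    have hid := hψ s hball' hLs
    have hsum := sum_mult_le hm hK₀ hK hS hψ hψb
    -- every zero of the package is at distance `≥ δ/2` from `s`
    have hdist : ∀ a ∈ S, δ / 2 ≤ ‖s - a‖ := by
      intro a ha
      obtain ⟨hLa, -, hadist⟩ := hS a ha
      have him : |a.im - s.im| ≤ 13 / 32 := by
        calc |a.im - s.im| = |(a - (17 / 16 + s.im * I)).im| := by simp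
          _ ≤ ‖a - (17 / 16 + s.im * I)‖ := Complex.abs_im_le_norm _
          _ ≤ 13 / 32 := hadist
      have haim : |a.im| ≤ H + 1 := by
        have := abs_sub_abs_le_abs_sub a.im s.im
        linarith
      have hare : a.re < 1 - δ := by
        by_contra h
        exact hzf a (not_lt.1 h) haim hLa
      calc δ / 2 ≤ s.re - a.re := by linarith
        _ = (s - a).re := by simp
        _ ≤ ‖s - a‖ := Complex.re_le_norm _
    have h1 : ‖∑ a ∈ S, (mult a : ℂ) / (s - a)‖ ≤ 2 / δ * ∑ a ∈ S, (mult a : ℝ) := by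
      calc ‖∑ a ∈ S, (mult a : ℂ) / (s - a)‖ ≤ ∑ a ∈ S, ‖(mult a : ℂ) / (s - a)‖ := norm_sum_le _ _
        _ ≤ ∑ a ∈ S, (mult a : ℝ) * (2 / δ) :=
            Finset.sum_le_sum fun a ha ↦ norm_natCast_div_le hδ (hdist a ha)
        _ = 2 / δ * ∑ a ∈ S, (mult a : ℝ) := by rw [← Finset.sum_mul, mul_comm]
    have h2 : ‖deriv (heckeL m) s / heckeL m s‖ ≤
        E * ℒ + 2 / δ * (8 * (8 + K₀ + E) * ℒ ^ 2) := by
      have heq : deriv (heckeL m) s / heckeL m s = ψ s + ∑ a ∈ S, (mult a : ℂ) / (s - a) := by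
        rw [hid]; ring
      rw [heq]
      refine (norm_add_le _ _).trans (add_le_add ((hψb s hball).trans ?_) ?_)
      · exact mul_le_mul_of_nonneg_left hℓ hE
      · refine h1.trans (mul_le_mul_of_nonneg_left (hsum.trans ?_) (by positivity))
        have hlsq : Real.log (|s.im| + 2 * m + 5) ^ 2 ≤ ℒ ^ 2 :=
          pow_le_pow_left₀ (by linarith) hℓ 2
        exact mul_le_mul_of_nonneg_left hlsq (by positivity)
    calc ‖deriv (heckeL m) s / heckeL m s‖ ≤ E * ℒ + 2 / δ * (8 * (8 + K₀ + E) * ℒ ^ 2) := h2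
      _ = (E * ℒ * δ + 16 * (8 + K₀ + E) * ℒ ^ 2) / δ := by
          field_simp
          ring
      _ ≤ (E * ℒ ^ 2 + 16 * (8 + K₀ + E) * ℒ ^ 2 + (16 + K₀) * ℒ ^ 2) / δ := by
          apply div_le_div_of_nonneg_right _ hδ.le
          have h5 : E * ℒ * δ ≤ E * ℒ ^ 2 :=
            calc E * ℒ * δ ≤ E * ℒ * 1 := by gcongr
              _ = E * ℒ := mul_one _
              _ ≤ E * ℒ ^ 2 := mul_le_mul_of_nonneg_left hℒ2 hE
          have h6 : 0 ≤ (16 + K₀) * ℒ ^ 2 := by positivity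
          linarith
      _ = C₁ * ℒ ^ 2 / δ := by rw [hC₁]; ring
  · have hs1 : 1 < s.re := by linarith
    have h := hK m s hs1 hre2
    rw [← norm_deriv_div_eq m hs1] at h
    have h4 : 1 / (s.re - 1) ≤ 16 := by
      rw [div_le_iff₀ (by linarith)]; linarith
    calc ‖deriv (heckeL m) s / heckeL m s‖ ≤ 1 / (s.re - 1) + K₀ := h
      _ ≤ (16 + K₀) * 1 := by linarith
      _ ≤ (16 + K₀) * ℒ ^ 2 := mul_le_mul_of_nonneg_left hℒ21 (by positivity)
      _ ≤ C₁ * ℒ ^ 2 := by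
          refine mul_le_mul_of_nonneg_right ?_ (by positivity)
          rw [hC₁]
          have : 0 ≤ E + 16 * (8 + K₀ + E) := by positivity
          linarith
      _ ≤ C₁ * ℒ ^ 2 / δ := hfinal

end GaussianHecke

end Literature.NumberTheory.LFunctions
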